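import Mathlib.Analysis.Real.Pi.Bounds
import Summits.Ventures.CertifiedManyBodySolver.Downfold.OneBandHarmonicEnclosure
import HarnessLib

/-!
# The direct one-band in-plane band, VIb: the first-order (mean-value) CELL ENCLOSURE on a block of grid cells

Venture CertifiedManyBodySolver, cell `pub/hubbard-downfold` (stage S1, technique B), seat hubbard-downfold-mod-4 (g25);
namespace `Summit.Ventures.CertifiedManyBodySolver.Downfold.Emery`. Everything here is PROVED; no number lives here.
WHAT THIS IS NOT: a statement about any material; `U = 0` one-body kinematics of a one-band Wannier Hamiltonian.

Layer 2b of the g25 CELL-TREE device: `cellEnclZ K cl ch S a0 a1 b0 b1` encloses `10²⁴·10⁶·K·ε(k)` on the closed block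
`[k_{a0}, k_{a1}] × [k_{b0}, k_{b1}]` as the intersection of the harmonic block enclosure (`bandEnclZ` of
`OneBandHarmonicEnclosure`) with the first-order form `ε(k_{a0}, k_{b0}) + ∂ₓε·Δkx + ∂ᵧε·Δky` (mean value theorem along
two segments; derivative enclosures `dbandEnclZ`; `π ≤ 3.141593`) — `cellEnclZ_sound`, NO monotonicity premise; leaf
tests `cellIn / cellOut` against a rational energy (`le_of_cellIn`, `lt_of_cellOut`).

Sources: mean-value (centred) form and subdivision [Moore1966, §3.2, Theorem 3.1, §4.4]; one-band form [AndersenEtAl1995, §6].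
-/

noncomputable section

namespace Summit.Ventures.CertifiedManyBodySolver.Downfold.Emery

open Real Set

/-! ## §4 The first-order (mean-value) cell enclosure -/

/-- `π ≤ 3141593/10⁶`. [folklore] -/
def piN : ℕ := 3141593

/-- [folklore] -/
theorem pi_le_piN : π ≤ (piN : ℝ) / (hH : ℝ) := by
  have := Real.pi_lt_d6
  unfold piN hH; norm_num; linarith

/-- Lower end of the increment enclosure `[0, w·π/K]·[dlo, dhi]` at scale `·10⁶·K`. [cite: Moore1966, §2.2] -/
def incLo (dlo : ℤ) (w : ℕ) : ℤ := min 0 (dlo * w * piN)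

/-- Upper end of the increment enclosure. [cite: Moore1966, §2.2] -/
def incHi (dhi : ℤ) (w : ℕ) : ℤ := max 0 (dhi * w * piN)

/-- **Soundness of the increment enclosure**: `y ∈ [dlo, dhi]`, `0 ≤ Δ ≤ w·π/K` ⇒
`10⁶·K·(y·Δ) ∈ [incLo dlo w, incHi dhi w]`. [cite: Moore1966, §2.2] -/
theorem inc_sound {dlo dhi : ℤ} {y Δ : ℝ} {w K : ℕ} (hK : 0 < K) (hy : ZEncl dlo dhi y) (hΔ0 : 0 ≤ Δ)
    (hΔ : Δ ≤ (w : ℝ) * π / K) :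
    ZEncl (incLo dlo w) (incHi dhi w) ((hH : ℝ) * K * (y * Δ)) := by
  obtain ⟨h1, h2⟩ := hy
  have hKr : (0 : ℝ) < K := by exact_mod_cast hK
  have hH0 : (0 : ℝ) < (hH : ℝ) := by unfold hH; norm_num
  set s : ℝ := (hH : ℝ) * K * Δ with hs
  have hs0 : 0 ≤ s := by positivity
  have hs1 : s ≤ (w : ℝ) * piN := by
    have hπ := pi_le_piN
    rw [le_div_iff₀ hH0] at hπ
    have : (hH : ℝ) * K * Δ ≤ (hH : ℝ) * (w * π) := by
      have := mul_le_mul_of_nonneg_left hΔ (le_of_lt (mul_pos hH0 hKr))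
      calc (hH : ℝ) * K * Δ = (hH : ℝ) * K * Δ := rfl
        _ ≤ (hH : ℝ) * K * ((w : ℝ) * π / K) := this
        _ = (hH : ℝ) * (w * π) := by field_simp
    nlinarith
  have hval : (hH : ℝ) * K * (y * Δ) = y * s := by rw [hs]; ring
  rw [hval]
  unfold incLo incHi ZEncl
  push_cast
  constructor
  · rcases le_total 0 y with hy0 | hy0
    · exact (min_le_left _ _).trans (mul_nonneg hy0 hs0)
    · refine (min_le_right _ _).trans ?_
      have : (dlo : ℝ) * (w * piN) ≤ y * s := by nlinarith
      linarith
  · rcases le_total 0 y with hy0 | hy0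
    · refine le_trans ?_ (le_max_right _ _)
      have : y * s ≤ (dhi : ℝ) * (w * piN) := by nlinarith
      linarith
    · exact (mul_nonpos_of_nonpos_of_nonneg hy0 hs0).trans (le_max_left _ _)

/-- **THE CELL ENCLOSURE** of `10²⁴·10⁶·K·ε` on the block `[k_{a0}, k_{a1}] × [k_{b0}, k_{b1}]`: the harmonic block
enclosure intersected with the first-order form around the corner `(k_{a0}, k_{b0})`. [cite: Moore1966, Theorem 3.1, §4.4] -/
def cellEnclZ (K : ℕ) (cl ch : ℕ → ℤ) (S : List (ℕ × ℕ × ℚ)) (a0 a1 b0 b1 : ℕ) : ℤ × ℤ :=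
  let CX := arcs4 K cl ch a0 a1
  let CY := arcs4 K cl ch b0 b1
  let CX0 := arcs4 K cl ch a0 a0
  let CY0 := arcs4 K cl ch b0 b0
  let SX := sarcs4 K cl ch a0 a1
  let SY := sarcs4 K cl ch b0 b1
  let hb := bandEnclZ S CX CY
  let p := bandEnclZ S CX0 CY0
  let dx := dbandEnclZ S SX CY
  let dy := dbandEnclZ S SY CX0
  let M : ℤ := (hH : ℤ) * K
  (max (hb.1 * M) (p.1 * M + incLo dx.1 (a1 - a0) + incLo dy.1 (b1 - b0)),
   min (hb.2 * M) (p.2 * M + incHi dx.2 (a1 - a0) + incHi dy.2 (b1 - b0)))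

/-- The cell scale `10²⁴·10⁶·K`. [folklore] -/
def cellScale (K : ℕ) : ℝ := bandScale * ((hH : ℝ) * K)

/-- `k_b − k_a = (b − a)π/K` for `a ≤ b`. [folklore] -/
theorem gridPt_sub {K a b : ℕ} (hab : a ≤ b) : gridPt K b - gridPt K a = ((b - a : ℕ) : ℝ) * π / K := by
  unfold gridPt; rw [Nat.cast_sub hab]; ring

/-- **SOUNDNESS OF THE CELL ENCLOSURE** (no monotonicity premise): for every momentum of the closed block,
`cellScale·ε(k) ∈ [lo, hi]`. [cite: Moore1966, Theorem 3.1, §4.4] -/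
theorem cellEnclZ_sound {K : ℕ} (hK : 0 < K) (hev : K % 2 = 0) {cl ch : ℕ → ℤ} (hT : CosEnclZ K cl ch)
    {S : List (ℕ × ℕ × ℚ)} (hS : hZOK S = true) {a0 a1 b0 b1 : ℕ} (ha : a0 ≤ a1) (hb : b0 ≤ b1) {kx ky : ℝ}
    (hx1 : gridPt K a0 ≤ kx) (hx2 : kx ≤ gridPt K a1) (hy1 : gridPt K b0 ≤ ky) (hy2 : ky ≤ gridPt K b1) :
    ZEncl (cellEnclZ K cl ch S a0 a1 b0 b1).1 (cellEnclZ K cl ch S a0 a1 b0 b1).2 (cellScale K * ipBandK S kx ky) := by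
  have hKr : (0 : ℝ) < K := by exact_mod_cast hK
  have hM : (0 : ℝ) ≤ (hH : ℝ) * K := by positivity
  -- harmonic block enclosure
  have hX := arcs4_sound hK hT a0 a1
  have hY := arcs4_sound hK hT b0 b1
  have hX0 := arcs4_sound hK hT a0 a0
  have hY0 := arcs4_sound hK hT b0 b0
  have hSX := sarcs4_sound hK hev hT a0 a1
  have hSY := sarcs4_sound hK hev hT b0 b1
  have hblk := bandEnclZ_sound hX hY hS hx1 hx2 hy1 hy2
  -- point value at the corner
  have hpt := bandEnclZ_sound hX0 hY0 hS (le_refl (gridPt K a0)) le_rfl (le_refl (gridPt K b0)) le_rfl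
  -- x-increment by the mean value theorem on `[k_{a0}, kx]` at fixed `ky`
  have hincx : ZEncl (incLo (dbandEnclZ S (sarcs4 K cl ch a0 a1) (arcs4 K cl ch b0 b1)).1 (a1 - a0))
      (incHi (dbandEnclZ S (sarcs4 K cl ch a0 a1) (arcs4 K cl ch b0 b1)).2 (a1 - a0))
      ((hH : ℝ) * K * (bandScale * (ipBandK S kx ky - ipBandK S (gridPt K a0) ky))) := by
    rcases eq_or_lt_of_le hx1 with heq | hlt
    · rw [← heq, sub_self, mul_zero, mul_zero]
      unfold ZEncl incLo incHi; push_cast; exact ⟨min_le_left _ _, le_max_left _ _⟩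
    · obtain ⟨ξ, hξ, hslope⟩ := exists_hasDerivAt_eq_slope (fun x => ipBandK S x ky) (fun x => ipBandDx S x ky)
        hlt (continuous_ipBandK_kx S ky).continuousOn (fun x _ => hasDerivAt_ipBandK_kx' S x ky)
      have hne : kx - gridPt K a0 ≠ 0 := sub_ne_zero.2 hlt.ne'
      have hdiff : ipBandK S kx ky - ipBandK S (gridPt K a0) ky = ipBandDx S ξ ky * (kx - gridPt K a0) := by
        rw [hslope]; field_simp
      have hd := dbandEnclZ_sound hSX hY hS hξ.1.le (hξ.2.le.trans hx2) hy1 hy2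
      have hΔ : kx - gridPt K a0 ≤ ((a1 - a0 : ℕ) : ℝ) * π / K := by rw [← gridPt_sub ha]; linarith
      have := inc_sound hK hd (sub_nonneg.2 hx1) hΔ
      refine this.congr ?_
      rw [hdiff]; ring
  -- y-increment along the edge `kx = k_{a0}`
  have hincy : ZEncl (incLo (dbandEnclZ S (sarcs4 K cl ch b0 b1) (arcs4 K cl ch a0 a0)).1 (b1 - b0))
      (incHi (dbandEnclZ S (sarcs4 K cl ch b0 b1) (arcs4 K cl ch a0 a0)).2 (b1 - b0))
      ((hH : ℝ) * K * (bandScale * (ipBandK S (gridPt K a0) ky - ipBandK S (gridPt K a0) (gridPt K b0)))) := by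
    rcases eq_or_lt_of_le hy1 with heq | hlt
    · rw [← heq, sub_self, mul_zero, mul_zero]
      unfold ZEncl incLo incHi; push_cast; exact ⟨min_le_left _ _, le_max_left _ _⟩
    · obtain ⟨η, hη, hslope⟩ := exists_hasDerivAt_eq_slope (fun y => ipBandK S (gridPt K a0) y)
        (fun y => ipBandDx S y (gridPt K a0)) hlt (continuous_ipBandK_ky S (gridPt K a0)).continuousOn
        (fun y _ => hasDerivAt_ipBandK_ky' S (gridPt K a0) y)
      have hne : ky - gridPt K b0 ≠ 0 := sub_ne_zero.2 hlt.ne'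
      have hdiff : ipBandK S (gridPt K a0) ky - ipBandK S (gridPt K a0) (gridPt K b0) =
          ipBandDx S η (gridPt K a0) * (ky - gridPt K b0) := by
        rw [hslope]; field_simp
      have hd := dbandEnclZ_sound hSY hX0 hS hη.1.le (hη.2.le.trans hy2) (le_refl (gridPt K a0)) le_rfl
      have hΔ : ky - gridPt K b0 ≤ ((b1 - b0 : ℕ) : ℝ) * π / K := by rw [← gridPt_sub hb]; linarith
      have := inc_sound hK hd (sub_nonneg.2 hy1) hΔ
      refine this.congr ?_
      rw [hdiff]; ring
  -- assemble
  obtain ⟨hb1, hb2⟩ := hblk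
  obtain ⟨hp1, hp2⟩ := hpt
  obtain ⟨hx1', hx2'⟩ := hincx
  obtain ⟨hy1', hy2'⟩ := hincy
  have hdecomp : cellScale K * ipBandK S kx ky =
      bandScale * ipBandK S (gridPt K a0) (gridPt K b0) * ((hH : ℝ) * K) +
      (hH : ℝ) * K * (bandScale * (ipBandK S kx ky - ipBandK S (gridPt K a0) ky)) +
      (hH : ℝ) * K * (bandScale * (ipBandK S (gridPt K a0) ky - ipBandK S (gridPt K a0) (gridPt K b0))) := by
    unfold cellScale; ring
  have hharm : cellScale K * ipBandK S kx ky = bandScale * ipBandK S kx ky * ((hH : ℝ) * K) := by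
    unfold cellScale; ring
  unfold cellEnclZ ZEncl
  simp only
  push_cast
  constructor
  · refine max_le ?_ ?_
    · rw [hharm]; exact mul_le_mul_of_nonneg_right hb1 hM
    · rw [hdecomp]; nlinarith [mul_le_mul_of_nonneg_right hp1 hM]
  · refine le_min ?_ ?_
    · rw [hharm]; exact mul_le_mul_of_nonneg_right hb2 hM
    · rw [hdecomp]; nlinarith [mul_le_mul_of_nonneg_right hp2 hM]

/-- [folklore] -/
theorem cellScale_pos {K : ℕ} (hK : 0 < K) : 0 < cellScale K := by
  unfold cellScale bandScale cosD hH
  have : (0 : ℝ) < K := by exact_mod_cast hK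
  positivity

/-- The cell scale as a rational. [folklore] -/
def cellScaleQ (K : ℕ) : ℚ := (cosD : ℚ) * cosD * hH * (hH * K)

/-- [folklore] -/
theorem cast_cellScaleQ (K : ℕ) : ((cellScaleQ K : ℚ) : ℝ) = cellScale K := by
  unfold cellScaleQ cellScale bandScale; push_cast; ring

/-- LEAF TEST «block inside the occupied set at energy `e`»: `hi ≤ e·scale`. [folklore] -/
def cellIn (K : ℕ) (cl ch : ℕ → ℤ) (S : List (ℕ × ℕ × ℚ)) (e : ℚ) (a0 a1 b0 b1 : ℕ) : Bool :=
  decide (((cellEnclZ K cl ch S a0 a1 b0 b1).2 : ℚ) ≤ e * cellScaleQ K)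

/-- LEAF TEST «block outside the occupied set at energy `e`»: `e·scale < lo`. [folklore] -/
def cellOut (K : ℕ) (cl ch : ℕ → ℤ) (S : List (ℕ × ℕ × ℚ)) (e : ℚ) (a0 a1 b0 b1 : ℕ) : Bool :=
  decide (e * cellScaleQ K < ((cellEnclZ K cl ch S a0 a1 b0 b1).1 : ℚ))

/-- **A passing `cellIn` puts the whole closed block below `e`.** [cite: Moore1966, Theorem 3.1, §4.4] -/
theorem le_of_cellIn {K : ℕ} (hK : 0 < K) (hev : K % 2 = 0) {cl ch : ℕ → ℤ} (hT : CosEnclZ K cl ch)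
    {S : List (ℕ × ℕ × ℚ)} (hS : hZOK S = true) {e : ℚ} {a0 a1 b0 b1 : ℕ} (ha : a0 ≤ a1) (hb : b0 ≤ b1)
    (h : cellIn K cl ch S e a0 a1 b0 b1 = true) {kx ky : ℝ}
    (hx1 : gridPt K a0 ≤ kx) (hx2 : kx ≤ gridPt K a1) (hy1 : gridPt K b0 ≤ ky) (hy2 : ky ≤ gridPt K b1) :
    ipBandK S kx ky ≤ (e : ℝ) := by
  have henc := (cellEnclZ_sound hK hev hT hS ha hb hx1 hx2 hy1 hy2).2
  unfold cellIn at h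
  have h' := (Rat.cast_le (K := ℝ)).2 (of_decide_eq_true h)
  push_cast at h'
  rw [cast_cellScaleQ] at h'
  have hsc := cellScale_pos hK
  nlinarith

/-- **A passing `cellOut` puts the whole closed block strictly above `e`.** [cite: Moore1966, Theorem 3.1, §4.4] -/
theorem lt_of_cellOut {K : ℕ} (hK : 0 < K) (hev : K % 2 = 0) {cl ch : ℕ → ℤ} (hT : CosEnclZ K cl ch)
    {S : List (ℕ × ℕ × ℚ)} (hS : hZOK S = true) {e : ℚ} {a0 a1 b0 b1 : ℕ} (ha : a0 ≤ a1) (hb : b0 ≤ b1)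
    (h : cellOut K cl ch S e a0 a1 b0 b1 = true) {kx ky : ℝ}
    (hx1 : gridPt K a0 ≤ kx) (hx2 : kx ≤ gridPt K a1) (hy1 : gridPt K b0 ≤ ky) (hy2 : ky ≤ gridPt K b1) :
    (e : ℝ) < ipBandK S kx ky := by
  have henc := (cellEnclZ_sound hK hev hT hS ha hb hx1 hx2 hy1 hy2).1
  unfold cellOut at h
  have h' := (Rat.cast_lt (K := ℝ)).2 (of_decide_eq_true h)
  push_cast at h'
  rw [cast_cellScaleQ] at h'
  have hsc := cellScale_pos hK
  nlinarith

end Summit.Ventures.CertifiedManyBodySolver.Downfold.Emery
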